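import Summits.AtomisticToContinuum.Crystallization.Theorems.FrustratedLawDichotomyStrainedPatchHomCurvLeaf2
import Summits.AtomisticToContinuum.Crystallization.Theorems.FrustratedLawDichotomyStrainedPatchHomConvexSegmentW45

/-!
# ξ-ELIMINATION GLUE: value at `ξ₀` + slope leaf + curvature leaf ⟹ the hcp energy sum on the whole shuffle box

decomp-a2c hand-1 g26 (crux `AperiodicFrustratedLawGap`, stmt-AtomisticToContinuum-27623; `(H) HomFloor (1/625)`, hcp half; lever (C)).  The three
certificates of `…HomConvexSegmentW45.hcpShifted_floor_W45` are now kernel Booleans (`…HomCurvLeaf2.curvCheck2 / slopeCheck2`) plus a value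
inequality at the reference shuffle.  ★★★ `hcpEnergy_of_xiElim`: for a `U`-box (entries under `Sum.inl`, common to all three boxes), a reference
shuffle box `X₀` (the slope box) inside the target shuffle box `X` (the curvature box):

  value `∀ U ξ₀ ∈ X₀: V₀ ≤ Σ_A(U) + Σ_{b∈L} W₄₅‖latPt U b + U(hcpShift+ξ₀)‖`  ∧  `slopeCheck2 c₀ w₀ L Gs`  ∧  `curvCheck2 c w L lamS` (`lamS > 0`)
  ⟹ `∀ U, ∀ ξ ∈ X: V₀ − (Gs/SC)²/(2·lamS/SC) ≤ Σ_A(U) + Σ_{b∈L} W₄₅‖latPt U b + U(hcpShift+ξ)‖`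

— the energy disjunct of the `(H)` certificate's `hver` for EVERY shuffle of the big box from data at one reference shuffle (one leaf per `U`-box).
NO definitions; 0 sorry; standard axioms; no instances / notation / `#eval`.  `--supports stmt-AtomisticToContinuum-27623`.
-/

noncomputable section

namespace Summit.AtomisticToContinuum.Crystallization.Theorems.FrustratedLawDichotomyStrainedPatchHomCurvLeaf

open scoped BigOperators RealInnerProductSpace
open Literature.Analysis.ValidatedNumerics.Numerics
open Summit.AtomisticToContinuum.Crystallization.Theorems.ChargedEnergyGapNegative (E3)
open Summit.AtomisticToContinuum.Crystallization.Theorems.FrustratedLawDichotomySchurCut (effPot w₄₅ ω₄)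
open Summit.AtomisticToContinuum.Crystallization.Theorems.FrustratedLawDichotomyStrainedPatchHomSplit (latPt hexFrame hcpShift)
open Summit.AtomisticToContinuum.Crystallization.Theorems.FrustratedLawDichotomyStrainedPatchHomConvexSegment (hcpShifted_floor_W45)
open Summit.AtomisticToContinuum.Crystallization.Theorems.FrustratedLawDichotomyStrainedPatchEnvelopeTaylor (Wrec)

/-- ★★★ **ξ-ELIMINATION FOR THE hcp ENERGY SUM** (one leaf per `U`-box).  Boxes: `(c₀, w₀)` = `U`-box × reference shuffle box, `(c, w)` = the SAME
`U`-box × target shuffle box containing the reference box; `L` duplicate-free.  From a value floor `V₀` for `Σ_A(U) + Σ_B(U, ξ₀)` on the reference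
box, `slopeCheck2 c₀ w₀ L Gs = true` and `curvCheck2 c w L lamS = true` with `0 < lamS`: for every self-map `U` with entries in the box and
`‖U − 1‖ ≤ 1/4` and every shuffle `ξ` of the target box with `‖ξ‖ ≤ 1/4` (given one reference shuffle `ξ₀` of norm `≤ 1/4` in the reference box),
`V₀ − (Gs/SC)²/(2·(lamS/SC)) ≤ Σ_A(U) + Σ_{b ∈ L} W₄₅‖latPt U hexFrame b + U(hcpShift + ξ)‖`. [folklore chaining: `hcpShifted_floor_W45`] -/
theorem hcpEnergy_of_xiElim {c₀ w₀ c w : (Fin 3 × Fin 3) ⊕ Fin 3 → ℤ} (hsame : ∀ ab : Fin 3 × Fin 3, c₀ (Sum.inl ab) = c (Sum.inl ab) ∧ w₀ (Sum.inl ab) = w (Sum.inl ab))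
    (hsub : ∀ (i : Fin 3) (x : ℝ), |x - (c₀ (Sum.inr i) : ℝ) / SC| ≤ (w₀ (Sum.inr i) : ℝ) / SC → |x - (c (Sum.inr i) : ℝ) / SC| ≤ (w (Sum.inr i) : ℝ) / SC)
    {L : List (Fin 3 → ℤ)} (hL : L.Nodup) {Gs lamS : ℤ} (hlam : 0 < lamS)
    (hslope : slopeCheck2 c₀ w₀ L Gs = true) (hcurv : curvCheck2 c w L lamS = true)
    (SA : (E3 →L[ℝ] E3) → ℝ) {V₀ : ℝ}
    (hval : ∀ (U : E3 →L[ℝ] E3) (ξ₀ : E3), ‖U - 1‖ ≤ 1 / 4 →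
      (∀ ab : Fin 3 × Fin 3, |(U (EuclideanSpace.single ab.2 (1 : ℝ))) ab.1 - (c₀ (Sum.inl ab) : ℝ) / SC| ≤ (w₀ (Sum.inl ab) : ℝ) / SC) →
      (∀ i : Fin 3, |ξ₀ i - (c₀ (Sum.inr i) : ℝ) / SC| ≤ (w₀ (Sum.inr i) : ℝ) / SC) → ‖ξ₀‖ ≤ 1 / 4 →
      V₀ ≤ SA U + ∑ b ∈ L.toFinset, effPot w₄₅ ω₄ (3 / 400) ‖latPt U hexFrame b + U (hcpShift + ξ₀)‖)
    (U : E3 →L[ℝ] E3) (hU : ‖U - 1‖ ≤ 1 / 4)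
    (hbox : ∀ ab : Fin 3 × Fin 3, |(U (EuclideanSpace.single ab.2 (1 : ℝ))) ab.1 - (c (Sum.inl ab) : ℝ) / SC| ≤ (w (Sum.inl ab) : ℝ) / SC)
    (ξ₀ : E3) (hξ₀ : ∀ i : Fin 3, |ξ₀ i - (c₀ (Sum.inr i) : ℝ) / SC| ≤ (w₀ (Sum.inr i) : ℝ) / SC) (hn₀ : ‖ξ₀‖ ≤ 1 / 4)
    (ξ : E3) (hξ : ∀ i : Fin 3, |ξ i - (c (Sum.inr i) : ℝ) / SC| ≤ (w (Sum.inr i) : ℝ) / SC) (hn : ‖ξ‖ ≤ 1 / 4) :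
    V₀ - ((Gs : ℝ) / SC) ^ 2 / (2 * ((lamS : ℝ) / SC)) ≤ SA U + ∑ b ∈ L.toFinset, effPot w₄₅ ω₄ (3 / 400) ‖latPt U hexFrame b + U (hcpShift + ξ)‖ := by
  have hS : (0 : ℝ) < SC := by norm_num [SC]
  have hlam' : (0 : ℝ) < (lamS : ℝ) / SC := div_pos (by exact_mod_cast hlam) hS
  -- entries of `U` in the reference box too
  have hbox₀ : ∀ ab : Fin 3 × Fin 3, |(U (EuclideanSpace.single ab.2 (1 : ℝ))) ab.1 - (c₀ (Sum.inl ab) : ℝ) / SC| ≤ (w₀ (Sum.inl ab) : ℝ) / SC := by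
    intro ab; rw [(hsame ab).1, (hsame ab).2]; exact hbox ab
  have hξ₀' : ∀ i : Fin 3, |ξ₀ i - (c (Sum.inr i) : ℝ) / SC| ≤ (w (Sum.inr i) : ℝ) / SC := fun i => hsub i _ (hξ₀ i)
  -- the three certificates
  have hV := hval U ξ₀ hU hbox₀ hξ₀ hn₀
  have hG := slope_bound_of_slopeCheck2 hL hslope U hU hbox₀ ξ₀ hξ₀ hn₀ ξ
  have hV' : V₀ - SA U ≤ ∑ b ∈ L.toFinset, Wrec ‖latPt U hexFrame b + U (hcpShift + ξ₀)‖ := by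
    unfold Wrec; linarith
  have key := hcpShifted_floor_W45 L.toFinset hU hn₀ hn hlam'
    (fun s hs hgood => curv_floor_of_curvCheck2 hL hcurv U hU hbox ξ₀ ξ hξ₀' hξ hn₀ hn hs hgood) hV' hG
  unfold Wrec at key
  linarith

end Summit.AtomisticToContinuum.Crystallization.Theorems.FrustratedLawDichotomyStrainedPatchHomCurvLeaf

end
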